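import Mathlib.Data.Fintype.Vector
import Literature.Computability.Complexity.TotalSearchProblem
import Literature.Computability.Complexity.CircuitEval
import Literature.Computability.Complexity.StackLists
import HarnessLib

/-!
# The canonical total search problems I: conventions, END-OF-LINE, END-OF-POTENTIAL-LINE

The succinctly presented search problems whose closures under many-one reductions are the
classes `PPAD`, `EOPL`/`CLS` — continued by `TFNPLocalSearch.lean` (SINK-OF-DAG, ITER,
LOCALOPT for `PLS`) and `TFNPClasses.lean` (LEAF, PIGEON for `PPA`, `PPP`, and the classes
themselves) — as `SearchProblem`s (`TotalSearchProblem.lean`) over the tree's vocabulary.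

**Circuits are programs of the proved universal evaluator.** A Boolean circuit with `k` output
bits is presented as a list `C : List (List Bool)` of `k` programs of the value-stack machine of
`CircuitEval.lean`, bit `j` of `C(w)` being the answer of `CircEval.evalFn ⟨w, C[j]⟩`
(`TFNP.evalBit`, `TFNP.evalBits`; `CircEval.evalFn ∈ FP` is `CircEval.evalFn_mem_FP`, every
`B₂`-circuit has such a program, `CircEval.evalFn_boolPair_desc`, and every program computes a
circuit of at most its own size, `CircuitEvalPrograms.lean` — so this presentation is polynomially
equivalent to circuits). Vertices of the implicit graphs are the strings of length `n`, the
distinguished vertex is `0ⁿ = TFNP.zero n` (the papers' `0ⁿ`, or "`1`" when `{0,1}ⁿ` is read as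
`[2ⁿ]`), and numerical values (potentials, costs) are read off an output string by `bitsToNat`
(least significant bit first, `BoolEncodings.lean`). An instance "`n` and circuits `C₁, …, C_r`"
is coded as `TFNP.instCode n [C₁, …, C_r] = ⟨1ⁿ, encList [encList C₁, …, encList C_r]⟩`
(`boolPair`, `unaryEncodeNat`, `encList`; `n` in unary so that vertices are polynomially short in
the code), and `TFNP.ofCircuits V Sol` is the search problem with valid instances the codes
satisfying `V n Cs` and solutions of `instCode n Cs` the strings `x` with `Sol n Cs x`
(`instCode_mem_ofCircuits_valid`, `boolPair_instCode_mem_ofCircuits_rel`; polynomial balance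
`ofCircuits_isPolyBalanced`). The side conditions of the papers ("`P(0ⁿ) = 0ⁿ ≠ S(0ⁿ)`", …,
"enforced syntactically") together with well-formedness (`r` circuits with `n` outputs where
required) form the promise `valid`; see `SearchProblemTotalize.lean` for its harmlessness.

| problem | data `Cs` | valid | solutions `x` (all with `|x| = n` unless said) | source |
|---|---|---|---|---|
| `EndOfLine` | `[S, P]` | `P 0 = 0 ≠ S 0` | `P (S x) ≠ x`, or `S (P x) ≠ x ≠ 0` | Pap94 §2; FGMS20 Def. 7; FGHS22 Def. 1 |
| `EndOfPotentialLine` | `[S, P, V]` | `P 0 = 0 ≠ S 0`, `V 0 = 0` | R1: as `EndOfLine`; R2: `S x ≠ x`, `P (S x) = x`, `V (S x) ≤ V x` | FGMS20 Def. 9 |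
| `SinkOfDag` | `[S, V]` | `S 0 ≠ 0` | `S x ≠ x` and (`S (S x) = S x` or `V (S x) ≤ V x`) | FGMS20 Def. 8 |
| `Iter` | `[C]` | `C 0 > 0` | `C x < x`, or `C x > x ∧ C (C x) = C x` (as numbers) | FGHS22 Def. 3 |
| `LocalOpt` | `[S, V]` | — | `V (S x) ≥ V x` | FGHS22 Def. 2 (JPY88) |

(`SinkOfDag`, `Iter`, `LocalOpt`: `TFNPLocalSearch.lean`; `Leaf`, `Pigeon`, the classes and
the reduction `EndOfPotentialLine ≤ₘ EndOfLine`: `TFNPClasses.lean`.) Proved API here: the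
generic unfolding / totality / solvability / balance lemmas of `ofCircuits`, polynomial balance
and TOTALITY of the two problems (`EndOfLine.isTotal`: `P ∘ S = id` would make `S` a bijection
of the finite vertex set with `S(0ⁿ) = 0ⁿ`; `EndOfPotentialLine.isTotal` from it). NOT here
(a stack-program exercise with `CircEval.evalFn_mem_FP`): `rel ∈ P` and `valid ∈ P`, hence
membership of the problems in `TFNP` and in their own classes; the completeness theorems (Pap94
§4, FGMS20 Thm. 10).

## References

* C. H. Papadimitriou, *On the complexity of the parity argument and other inefficient proofs of
  existence*, JCSS 48 (1994), §2 pp. 504–506 (PPAD, the standard source `0…0`, reductions).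
* J. Fearnley, S. Gordon, R. Mehta, R. Savani, *Unique end of potential line*, JCSS 114 (2020);
  arXiv:1811.03841 §2, Def. 7 (END-OF-LINE), Def. 8 (SINK-OF-DAG), Def. 9 (END-OF-POTENTIAL-LINE).
* J. Fearnley, P. W. Goldberg, A. Hollender, R. Savani, *The complexity of gradient descent*,
  J. ACM 70 (2022); arXiv:2011.01929 §3.1.2, Def. 1 (END-OF-LINE).
-/

namespace Literature.Computability.Complexity

open _root_.Computability

namespace TFNP

/-! ### Circuits as programs; vertices; instance codes -/

/-- The output bit of the program `d` on input `w`: the answer of the universal evaluator on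
`⟨w, d⟩` (`CircEval.evalFn` always answers one bit). [Arora–Barak 2009, Thm. 6.18 (proof:
circuit evaluation)] [folklore] -/
def evalBit (d w : List Bool) : Bool :=
  (CircEval.evalFn (boolPair w d)).headD false

/-- A circuit with `k` outputs as a list of `k` programs: `evalBits C w = [C₀(w), …, C_{k-1}(w)]`.
[Papadimitriou 1994, §5 ("a Boolean circuit C with n inputs and n outputs")] [folklore] -/
def evalBits (C : List (List Bool)) (w : List Bool) : List Bool :=
  C.map fun d => evalBit d w

/-- A `k`-output circuit answers `k` bits. [folklore] -/
@[simp] theorem length_evalBits (C : List (List Bool)) (w : List Bool) :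
    (evalBits C w).length = C.length :=
  List.length_map _

/-- The evaluator's answer is the singleton of `evalBit`. [folklore] -/
theorem evalFn_boolPair (d w : List Bool) : CircEval.evalFn (boolPair w d) = [evalBit d w] :=
  rfl

/-- Link with the rendering `decide (evalFn ⟨w, d⟩ = [true])` used in route statements. [folklore] -/
theorem evalBit_eq_decide (d w : List Bool) :
    evalBit d w = decide (CircEval.evalFn (boolPair w d) = [true]) := by
  rw [evalFn_boolPair]
  cases evalBit d w <;> decide

/-- The distinguished vertex `0ⁿ`. [Papadimitriou 1994, §2 ("0…0, the standard leaf")]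
[cite: Papadimitriou1994Parity, §2] -/
def zero (n : ℕ) : List Bool :=
  List.replicate n false

/-- `0ⁿ` has length `n`. [folklore] -/
@[simp] theorem length_zero (n : ℕ) : (zero n).length = n :=
  List.length_replicate

/-- `0ⁿ` has value `0`. [folklore] -/
@[simp] theorem bitsToNat_zero (n : ℕ) : bitsToNat (zero n) = 0 :=
  bitsToNat_replicate_false n

/-- Strings of equal length with equal values are equal (`bitsToNat` is injective on `{0,1}ⁿ`).
(Twin of `BruteForce.bitsToNat_injective_of_length_eq` of `FineGrained/SATBruteForceCount.lean`,
an unrelated host not imported here; refactor: both belong next to `bitsToNat` in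
`BoolEncodings.lean`.) [folklore] -/
theorem bitsToNat_injOn_length {v w : List Bool} (hl : v.length = w.length)
    (h : bitsToNat v = bitsToNat w) : v = w := by
  induction v generalizing w with
  | nil => cases w with
    | nil => rfl
    | cons b w => simp at hl
  | cons a v ih =>
    cases w with
    | nil => simp at hl
    | cons b w =>
      simp only [List.length_cons, Nat.add_right_cancel_iff] at hl
      simp only [bitsToNat_cons] at h
      have hab : a = b := by
        cases a <;> cases b <;> simp [Bool.toNat] at h ⊢ <;> omega
      subst hab
      rw [ih hl (by omega)]

/-- The code of the instance "`n` and the circuits `Cs`": `⟨1ⁿ, encList (Cs.map encList)⟩`.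
[Arora–Barak 2009, §0.1 (representing tuples of strings)] [folklore] -/
def instCode (n : ℕ) (Cs : List (List (List Bool))) : List Bool :=
  boolPair (unaryEncodeNat n) (encList (Cs.map encList))

/-- `encList` is injective (twin of `ClockedUA.encList_injective` /
`ModExpBlock.encList_injective`, whose unrelated host files are not imported; refactor: the
canonical home is next to `encList` in `StackLists.lean`). [folklore] -/
theorem encList_injective : Function.Injective encList
  | [], [], _ => rfl
  | [], a :: l, h | a :: l, [], h => by
    have := congrArg List.length h
    simp only [encList_nil, List.length_nil, encList_cons, length_boolPair] at this
    omega
  | a :: l, b :: l', h => by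
    have h' := congrArg boolUnpair h
    rw [encList_cons, encList_cons, boolUnpair_boolPair, boolUnpair_boolPair, Prod.mk.injEq] at h'
    rw [h'.1, encList_injective h'.2]

/-- Instance codes are uniquely decodable. [folklore] -/
theorem instCode_inj {n n' : ℕ} {Cs Cs' : List (List (List Bool))}
    (h : instCode n Cs = instCode n' Cs') : n = n' ∧ Cs = Cs' := by
  have h' := congrArg boolUnpair h
  rw [instCode, instCode, boolUnpair_boolPair, boolUnpair_boolPair, Prod.mk.injEq] at h'
  refine ⟨?_, List.map_injective_iff.2 encList_injective (encList_injective h'.2)⟩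
  rw [← unary_decode_encode_nat n, h'.1, unary_decode_encode_nat]

/-- `|1ⁿ| = n` (Mathlib's `unaryDecodeNat` is `List.length`). [folklore] -/
private theorem length_unaryEncodeNat (n : ℕ) : (unaryEncodeNat n).length = n :=
  unary_decode_encode_nat n

/-- Componentwise injectivity of the pairing. [Arora–Barak 2009, §0.1] [folklore] -/
private theorem boolPair_inj {a b a' b' : List Bool} (h : boolPair a b = boolPair a' b') :
    a = a' ∧ b = b' :=
  Prod.mk.inj (boolPair_injective (a₁ := (a, b)) (a₂ := (a', b')) h)

/-- The parameter `n` is at most the length of the code (unary coding). [folklore] -/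
theorem le_length_instCode (n : ℕ) (Cs : List (List (List Bool))) : n ≤ (instCode n Cs).length := by
  rw [instCode, length_boolPair, length_unaryEncodeNat]
  omega

/-! ### Search problems presented by circuits -/

/-- The search problem with valid instances the codes `instCode n Cs` with `V n Cs` and
solutions of `instCode n Cs` the strings `x` with `Sol n Cs x`. [folklore] -/
def ofCircuits (V : ℕ → List (List (List Bool)) → Prop)
    (Sol : ℕ → List (List (List Bool)) → List Bool → Prop) : SearchProblem where
  valid := {z | ∃ (n : ℕ) (Cs : List (List (List Bool))), z = instCode n Cs ∧ V n Cs}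
  rel := {w | ∃ (n : ℕ) (Cs : List (List (List Bool))) (x : List Bool),
    w = boolPair (instCode n Cs) x ∧ Sol n Cs x}

variable {V : ℕ → List (List (List Bool)) → Prop} {Sol : ℕ → List (List (List Bool)) → List Bool → Prop}

/-- Valid instances of `ofCircuits V Sol`. [folklore] -/
@[simp] theorem instCode_mem_ofCircuits_valid {n : ℕ} {Cs : List (List (List Bool))} :
    instCode n Cs ∈ (ofCircuits V Sol).valid ↔ V n Cs := by
  refine ⟨?_, fun h => ⟨n, Cs, rfl, h⟩⟩
  rintro ⟨n', Cs', h, hV⟩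
  obtain ⟨rfl, rfl⟩ := instCode_inj h
  exact hV

/-- Solutions of `ofCircuits V Sol`. [folklore] -/
@[simp] theorem boolPair_instCode_mem_ofCircuits_rel {n : ℕ} {Cs : List (List (List Bool))}
    {x : List Bool} : boolPair (instCode n Cs) x ∈ (ofCircuits V Sol).rel ↔ Sol n Cs x := by
  refine ⟨?_, fun h => ⟨n, Cs, x, rfl, h⟩⟩
  rintro ⟨n', Cs', x', h, hS⟩
  obtain ⟨h1, rfl⟩ := boolPair_inj h
  obtain ⟨rfl, rfl⟩ := instCode_inj h1
  exact hS

/-- Totality of `ofCircuits V Sol`, unfolded. [folklore] -/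
theorem ofCircuits_isTotal_iff :
    (ofCircuits V Sol).IsTotal ↔ ∀ (n : ℕ) (Cs : List (List (List Bool))), V n Cs → ∃ x, Sol n Cs x := by
  refine ⟨fun h n Cs hV => ?_, ?_⟩
  · obtain ⟨x, hx⟩ := h _ (instCode_mem_ofCircuits_valid.2 hV)
    exact ⟨x, boolPair_instCode_mem_ofCircuits_rel.1 hx⟩
  · rintro h z ⟨n, Cs, rfl, hV⟩
    obtain ⟨x, hx⟩ := h n Cs hV
    exact ⟨x, boolPair_instCode_mem_ofCircuits_rel.2 hx⟩

/-- Solvability in `FP` of `ofCircuits V Sol`, unfolded. [folklore] -/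
theorem ofCircuits_solvableInFP_iff : (ofCircuits V Sol).SolvableInFP ↔
    ∃ g ∈ FP, ∀ (n : ℕ) (Cs : List (List (List Bool))), V n Cs → Sol n Cs (g (instCode n Cs)) := by
  refine ⟨?_, ?_⟩
  · rintro ⟨g, hg, h⟩
    exact ⟨g, hg, fun n Cs hV =>
      boolPair_instCode_mem_ofCircuits_rel.1 (h _ (instCode_mem_ofCircuits_valid.2 hV))⟩
  · rintro ⟨g, hg, h⟩
    refine ⟨g, hg, ?_⟩
    rintro z ⟨n, Cs, rfl, hV⟩
    exact boolPair_instCode_mem_ofCircuits_rel.2 (h n Cs hV)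

/-- Polynomial balance from a linear bound `|x| ≤ c n + c` on solutions (`n ≤ |code|`). [folklore] -/
theorem ofCircuits_isPolyBalanced (c : ℕ)
    (h : ∀ (n : ℕ) (Cs : List (List (List Bool))) (x : List Bool), Sol n Cs x → x.length ≤ c * n + c) :
    (ofCircuits V Sol).IsPolyBalanced := by
  refine ⟨Polynomial.C c * Polynomial.X + Polynomial.C c, ?_⟩
  rintro z x ⟨n, Cs, x', hz, hS⟩
  obtain ⟨rfl, rfl⟩ := boolPair_inj hz
  have h1 := h n Cs x hS
  have h2 := le_length_instCode n Cs
  simp only [Polynomial.eval_add, Polynomial.eval_mul, Polynomial.eval_C, Polynomial.eval_X]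
  nlinarith

/-! ### END-OF-LINE -/

/-- Side condition of END-OF-LINE on `(n, [S, P])`: successor and predecessor circuits with `n`
outputs and `P(0ⁿ) = 0ⁿ ≠ S(0ⁿ)`. [FGMS 2020, Def. 7; FGHS 2022, Def. 1; Papadimitriou 1994, §2]
[cite: FearnleyGordonMehtaSavani2020, Def. 7] -/
def EndOfLine.IsValid (n : ℕ) : List (List (List Bool)) → Prop
  | [S, P] => S.length = n ∧ P.length = n ∧
      evalBits P (zero n) = zero n ∧ evalBits S (zero n) ≠ zero n
  | _ => False

/-- Solutions of END-OF-LINE: a vertex `x ∈ {0,1}ⁿ` with `P(S(x)) ≠ x` (end of a line), or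
`S(P(x)) ≠ x ≠ 0ⁿ` (start of a line other than `0ⁿ`). [FGMS 2020, Def. 7 (E1, E2); FGHS 2022,
Def. 1; Papadimitriou 1994, §2 ("any source or sink other than the standard source")]
[cite: FearnleyGordonMehtaSavani2020, Def. 7] -/
def EndOfLine.IsSolution (n : ℕ) : List (List (List Bool)) → List Bool → Prop
  | [S, P], x => x.length = n ∧
      (evalBits P (evalBits S x) ≠ x ∨ (evalBits S (evalBits P x) ≠ x ∧ x ≠ zero n))
  | _, _ => False

/-- **END-OF-LINE.** Given circuits `S, P : {0,1}ⁿ → {0,1}ⁿ` with `P(0ⁿ) = 0ⁿ ≠ S(0ⁿ)`, find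
`x` with `P(S(x)) ≠ x` or `S(P(x)) ≠ x ≠ 0ⁿ`. The presenting problem of `PPAD`.
[Papadimitriou 1994, §2 (PPAD); FGMS 2020, Def. 7; FGHS 2022, Def. 1]
[cite: FearnleyGordonMehtaSavani2020, Def. 7] -/
def EndOfLine : SearchProblem :=
  ofCircuits EndOfLine.IsValid EndOfLine.IsSolution

/-- END-OF-LINE is polynomially balanced (solutions have length `n`). [folklore] -/
theorem EndOfLine.isPolyBalanced : EndOfLine.IsPolyBalanced := by
  refine ofCircuits_isPolyBalanced 1 fun n Cs x h => ?_
  match Cs, h with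
  | [S, P], h => simp only [EndOfLine.IsSolution] at h; omega

/-- **END-OF-LINE is total.** If no vertex were a solution then `P(S(x)) = x` on `{0,1}ⁿ`, so `S`
would be injective on the finite vertex set, hence surjective; but the preimage `y` of `0ⁿ` has
`y = P(S(y)) = P(0ⁿ) = 0ⁿ`, i.e. `S(0ⁿ) = 0ⁿ` — contradicting the side condition. (The
injectivity form of "a finite directed graph with in/out-degree ≤ 1 and a source has a sink";
Papadimitriou's parity argument proper is needed only for the finer PPA statements.)
[Papadimitriou 1994, §1–2 ("any source or sink other than the standard source" exists by the
parity argument); FGMS 2020, §2 ("there must at least exist a solution of type E1")]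
[cite: Papadimitriou1994Parity, §2] -/
theorem EndOfLine.isTotal : EndOfLine.IsTotal := by
  classical
  refine ofCircuits_isTotal_iff.2 fun n Cs hV => ?_
  match Cs, hV with
  | [S, P], hV =>
    obtain ⟨hS, -, hP0, hS0⟩ := hV
    by_contra hno
    have hPS : ∀ x : List Bool, x.length = n → evalBits P (evalBits S x) = x := fun x hx => by
      by_contra h
      exact hno ⟨x, by simp only [EndOfLine.IsSolution]; exact ⟨hx, Or.inl h⟩⟩
    let s : List.Vector Bool n → List.Vector Bool n := fun v =>
      ⟨evalBits S v.1, by rw [length_evalBits, hS]⟩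
    have hinj : Function.Injective s := fun v w h => by
      have h' : evalBits S v.1 = evalBits S w.1 := congrArg Subtype.val h
      exact Subtype.ext (by rw [← hPS v.1 v.2, ← hPS w.1 w.2, h'])
    obtain ⟨y, hy⟩ := Finite.surjective_of_injective hinj ⟨zero n, length_zero n⟩
    have hy' : evalBits S y.1 = zero n := congrArg Subtype.val hy
    have hy0 : y.1 = zero n := by rw [← hPS y.1 y.2, hy', hP0]
    rw [hy0] at hy'
    exact hS0 hy'

/-! ### END-OF-POTENTIAL-LINE -/

/-- Side condition of END-OF-POTENTIAL-LINE on `(n, [S, P, V])`: `P(0ⁿ) = 0ⁿ ≠ S(0ⁿ)` and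
`V(0ⁿ) = 0` (the potential `V` may have any number `m` of output bits, read by `bitsToNat`).
[FGMS 2020, Def. 9] [cite: FearnleyGordonMehtaSavani2020, Def. 9] -/
def EndOfPotentialLine.IsValid (n : ℕ) : List (List (List Bool)) → Prop
  | [S, P, V] => S.length = n ∧ P.length = n ∧ evalBits P (zero n) = zero n ∧
      evalBits S (zero n) ≠ zero n ∧ bitsToNat (evalBits V (zero n)) = 0
  | _ => False

/-- Solutions of END-OF-POTENTIAL-LINE: (R1) `S(P(x)) ≠ x ≠ 0ⁿ` or `P(S(x)) ≠ x`; (R2) `S(x) ≠ x`,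
`P(S(x)) = x` and `V(S(x)) − V(x) ≤ 0`. [FGMS 2020, Def. 9 (R1, R2)]
[cite: FearnleyGordonMehtaSavani2020, Def. 9] -/
def EndOfPotentialLine.IsSolution (n : ℕ) : List (List (List Bool)) → List Bool → Prop
  | [S, P, V], x => x.length = n ∧
      ((evalBits S (evalBits P x) ≠ x ∧ x ≠ zero n) ∨ evalBits P (evalBits S x) ≠ x ∨
        (evalBits S x ≠ x ∧ evalBits P (evalBits S x) = x ∧
          bitsToNat (evalBits V (evalBits S x)) ≤ bitsToNat (evalBits V x)))
  | _, _ => False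

/-- **END-OF-POTENTIAL-LINE.** Given `S, P : {0,1}ⁿ → {0,1}ⁿ` with `P(0ⁿ) = 0ⁿ ≠ S(0ⁿ)` and a
potential `V : {0,1}ⁿ → {0, …, 2ᵐ − 1}` with `V(0ⁿ) = 0`, find an R1 or R2 point. The presenting
problem of the class `EOPL` (`= CLS = PPAD ∩ PLS`). [FGMS 2020, Def. 9]
[cite: FearnleyGordonMehtaSavani2020, Def. 9] -/
def EndOfPotentialLine : SearchProblem :=
  ofCircuits EndOfPotentialLine.IsValid EndOfPotentialLine.IsSolution

/-- **END-OF-POTENTIAL-LINE is total**: its END-OF-LINE part `(S, P)` is a valid END-OF-LINE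
instance, whose solutions (`EndOfLine.isTotal`) are solutions of type R1. [FGMS 2020, §2 ("To
solve the problem, it suffices to solve either of these problems")]
[cite: FearnleyGordonMehtaSavani2020, Def. 9] -/
theorem EndOfPotentialLine.isTotal : EndOfPotentialLine.IsTotal := by
  refine ofCircuits_isTotal_iff.2 fun n Cs hV => ?_
  match Cs, hV with
  | [S, P, V], hV =>
    obtain ⟨hS, hP, hP0, hS0, -⟩ := hV
    obtain ⟨x, hx⟩ := ofCircuits_isTotal_iff.1 EndOfLine.isTotal n [S, P] ⟨hS, hP, hP0, hS0⟩
    refine ⟨x, ?_⟩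
    simp only [EndOfLine.IsSolution, EndOfPotentialLine.IsSolution] at hx ⊢
    exact ⟨hx.1, by tauto⟩

/-- END-OF-POTENTIAL-LINE is polynomially balanced. [folklore] -/
theorem EndOfPotentialLine.isPolyBalanced : EndOfPotentialLine.IsPolyBalanced := by
  refine ofCircuits_isPolyBalanced 1 fun n Cs x h => ?_
  match Cs, h with
  | [S, P, V], h => simp only [EndOfPotentialLine.IsSolution] at h; omega

end TFNP

end Literature.Computability.Complexity
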